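import Literature.AlgebraicGeometry.Frobenioids.Prop55Sub
import HarnessLib

/-!
# Frobenioids I, Proposition 5.5 (iii), "Finally" (rationally standard type) — the REPAIRED named slot
# with the support predicate of Def. 2.4 (i)(d) bound canonically

Mochizuki, *The geometry of Frobenioids I: the general theory*, Kyushu J. Math. **62** (2008)
293–400, §5, Proposition 5.5 (iii) p. 104 ll. 37–39 ("Finally, suppose further that `C` is not of
group-like type. Then if `C` is of standard (respectively, rationally standard) type, then so are
`C^un-tr`, `C^rlf`"), Def. 4.5 (ii)/(iii) p. 86 (rational / rationally standard type: "for every prime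
`𝔭 ∈ Prime(Φ(A))` there is an element `a − b ∈ Φ^birat(A)`, `a, b ∈ Φ(A)`, with `𝔭 ∈ Supp(a)`,
`𝔭 ∉ Supp(b)`"), Def. 2.4 (i)(c)(d) p. 47 (`Supp(a)`, the set of primes at which the factorization of `a`
is nonzero) and §0 p. 12 (primary elements, `≼`, `Prime(M)`). [cite: MochizukiFrdI2008, Prop. 5.5 (iii) p.104]

STATEMENTS file (cell abc-iut, sub-DAG S7 row `FrdI:Prop5.5(iii)/P55-L07`, seat abc-iut-w5-d250; successor
slot authorised by L1-lead R85 (3) / R89 (9), GAP row P55iii-F1). The named slot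
`FrdI.Prop55Sub.Prop55iii_untr_rlf_ratStd hF hΦ Supp SuppR` of `Prop55Sub.lean` (seat abc-iut-w4-d084)
carries TWO FREE support predicates — `Supp` on `Φ` (hypothesis side and `C^un-tr` side) and an UNRELATED
`SuppR` on `Φ^rlf` (`C^rlf` side) — so its `C^rlf` conjunct asks for rationality of `C^rlf` with respect
to an ARBITRARY `SuppR` (e.g. the empty one) and is not closable (GAP P55iii-F1); its `C^un-tr` conjunct is
proved (`Prop55SubRatStdClosers.lean`, `FrdI.Prop55Sub.prop55iii_untr_ratStd_of`). Print's `Supp` is not a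
parameter: it is THE support of the factorization of a perf-factorial monoid (Def. 2.4 (i)(d)), which the
cell reads on primary elements as the support axiom "`𝔭 ∈ Supp(a)` iff some primary `a₀` of the class
`𝔭` satisfies `a₀ ≼ a`" (`GeometricFrobenioidRational`, `ArithmeticFrobenioidRational`, `PerfFactorialSupport`).
Here:
* `PrimarySupp a 𝔭` — that canonical support predicate, for any commutative monoid (Def. 2.4 (i)(d) read
  on primaries; agrees with the support of the factorization for perf-factorial monoids by seat
  abc-iut-L1-d2's `IsPerfFactorial.mem_supp_factorMap_of_iff'`);
  (Def. 4.5 (ii)/(iii) depend on the support predicate only through its extension, so every consumer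
  whose `Supp` obeys the support axiom may rewrite to `PrimarySupp`: `isOfRationallyStandardType_congr_supp`
  in the proof-only companion `Prop55SubRatStdRlfClosers.lean`);
* **`FrdI.Prop55Sub.Prop55iii_untr_rlf_ratStd'`** — the repaired slot: Prop. 5.5 (iii) "Finally",
  rationally standard, for `C^un-tr` AND `C^rlf`, with the support predicates of `Φ` and of `Φ^rlf` both
  `PrimarySupp`. Named statement, NOT asserted; closers go to proof-only companions.
No statement of the paper is strengthened; nothing here bears on [IUTchIII] Cor. 3.12.
-/

namespace Literature.AlgebraicGeometry.Frobenioids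

open CategoryTheory Opposite

universe w v v' u u'

/-! ### Def. 2.4 (i)(d) read on primary elements: the canonical support predicate -/

/-- **`𝔭 ∈ Supp(a)`** (Def. 2.4 (i)(d), read on primary elements as everywhere in the cell): some primary
element `a₀` of the class `𝔭 ∈ Prime(M)` satisfies `a₀ ≼ a`. For a perf-factorial `M` this is membership of
the prime of `M^pf` corresponding to `𝔭` in the support of the factorization of `a`
(`IsPerfFactorial.mem_supp_factorMap_of_iff'`). [cite: MochizukiFrdI2008, Def. 2.4 (i) p.47] -/
def PrimarySupp {M : Type w} [CommMonoid M] (a : M) (𝔭 : Primes M) : Prop :=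
  ∃ (a₀ : M) (h₀ : IsPrimary a₀), Quotient.mk (primarySetoid M) ⟨a₀, h₀⟩ = 𝔭 ∧ Precsim a₀ a

/-! ### The repaired slot -/

namespace FrdI.Prop55Sub

open PreFrobenioid

variable {D : Type u} [Category.{v} D] {Φ : Dᵒᵖ ⥤ CommMonCat.{w}}
  {C : Type u'} [Category.{v'} C] (F : C ⥤ ElemFrobenioid Φ)

/-- **Proposition 5.5 (iii)**, "Finally", rationally standard type — REPAIRED successor of
`Prop55iii_untr_rlf_ratStd` (GAP P55iii-F1): for `C` of Frobenius-isotropic and Frobenius-normalized type and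
NOT of group-like type, if `C` is of rationally standard type then so are `C^un-tr` and — for `Φ`
perf-factorial and given that `C^rlf → F_{Φ^rlf}` is a Frobenioid (hypothesis `hR`, to form its
birationalizations) — `C^rlf`; all three over THE parameters `rsParams` (THE birationalizations and
unit-trivialisations) with THE support predicate of Def. 2.4 (i)(d) (`PrimarySupp`) on `Φ`, resp. `Φ^rlf`.
Named statement, NOT asserted. [cite: MochizukiFrdI2008, Prop. 5.5 (iii) p.104] -/
def Prop55iii_untr_rlf_ratStd' (hF : IsFrobenioid F) (hΦ : IsPerfFactorialOn Φ) : Prop :=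
  IsOfType (IsFrobeniusIsotropic F) → IsOfType (IsFrobeniusNormalized F) →
    ¬ IsOfType (IsGroupLikeObj F) →
      (PreFrobenioidData.ofFunctor Φ F).IsOfRationallyStandardType
          (rsParams hF fun a 𝔭 => PrimarySupp a 𝔭) →
        (PreFrobenioidData.ofFunctor Φ (untrFunctor hF)).IsOfRationallyStandardType
            (rsParams (isFrobenioid_untr hF) fun a 𝔭 => PrimarySupp a 𝔭) ∧
          ∀ hR : IsFrobenioid (rlfToElem F hΦ),
            (PreFrobenioidData.ofFunctor _ (rlfToElem F hΦ)).IsOfRationallyStandardType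
              (rsParams hR fun a 𝔭 => PrimarySupp a 𝔭)

end FrdI.Prop55Sub

end Literature.AlgebraicGeometry.Frobenioids
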